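import Summits.BirchSwinnertonDyer.BirchSwinnertonDyer.Theorems.ResidualThetaTransportAtTwoSeparatedLatticeRank
import Summits.BirchSwinnertonDyer.BirchSwinnertonDyer.Theorems.KatoDescentPotSupersingularKatoFiniteLevelStrictCompactKernel
import Literature.NumberTheory.EllipticCurves.Kato2004.IwasawaH1ReductionSeparated
import Literature.NumberTheory.EllipticCurves.Kato2004.IwasawaH1ReductionPkSemilinear
import Literature.NumberTheory.EllipticCurves.LambdaAdicSelmerDataLevelProofs
import HarnessLib

/-!
# Input (Λ3c) of the `Λ`-adic road to SURJ⁺@2 (item 23110), cohomological half: the RANK BOUND of the engine for level groups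
# pulled back from a fixed discrete group — `ℤ_p`-independent classes `y_1, …, y_m ∈ H¹(U, T_pE)` whose reductions
# `ι_k(red_{p^k} y_i)` lie in `A` number at most `log_p #A[p]`

Routes `ResidualThetaTransportAtTwo` (RTT, crux r201 `ResidualLambdaFormulaNegDiscAtTwo`, stmt-BirchSwinnertonDyer-23110) /
`ThetaPartnerAtTwo` (K1 `stub_surj2`). Seat `prover-bsd-wall-tp2-p2x-w2` g14; `--supports stmt-BirchSwinnertonDyer-23110`.
THEOREMS ONLY (no definition, no named fact, no `sorry`); closes nothing.

WHY. The engine of the road (`…UniversalNormMittagLeffler.exists_transition_eq_zero`, p654128) displays the rank bound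
«`hB`: every `ℤ_p`-linearly independent `v : Fin m → H¹(ℚ_n, T_pE)` with all `red_{p^k}(v i) ∈ C n k` has `m ≤ B`». For level groups
`C n k = ι_{n,k}⁻¹(A)` pulled back along INJECTIVE additive maps `ι_{n,k} : H¹(ℚ_n, E[p^k]) → H_∞` (e.g. restriction to `ℚ_∞`
composed with `E[p^k] ↪ E[p^∞]`, injective when `E(ℚ_∞)[p] = 0`) from ONE subgroup `A ≤ H_∞` (e.g. `Sel⁺(E/ℚ_∞) ≤ H¹(ℚ_∞, E[p^∞])`),
THIS FILE supplies `hB` with `B = d` whenever `#A[p] ≤ p^d` — uniformly in `n`, since `A` does not depend on `n`: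

* `le_of_linearIndependent_of_reduceH1Pk_mem` — for ANY `U ≤ Γ_ℚ` with `H¹(U, T_pE)` free of `p`-torsion, any injective additive
  `ι_k : H¹(U, E[p^k]) → H_∞`, any `A ≤ H_∞` with `A[p]` finite, `#A[p] ≤ p^d`: independent `v_1, …, v_m ∈ H¹(U, T_pE)` with
  `ι_k(red_{p^k} v_i) ∈ A` for all `i, k` satisfy `m ≤ d`. It is the pure-algebra counting `le_of_linearIndependent_of_maps`
  (`…SeparatedLatticeRank`, this seat: Artin–Rees for lattices in the separated torsion-free `H¹(U, T_pE)` + `#A[p^k] ≤ #A[p]^k`)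
  fed with `Φ_k = ι_k ∘ red_{p^k}`: `ker Φ_k ⊆ p^k H¹(U, T_pE)` (tree `KatoFiniteLevelCount.exists_pow_smul_eq_of_reduceH1Pk_eq_zero`,
  the Bockstein sequence of `0 → T → T → E[p^k] → 0`), `p^k Φ_k = 0` (`p^k` kills `H¹(U, E[p^k])`,
  `LambdaAdicSelmerDataExists.pow_nsmul_eq_zero`), separatedness `⋂ p^k H¹(U, T_pE) = 0` (tree `eq_zero_of_forall_mem_pow_smul`), and
  the lattice `Σ ℤ_p v_i` reduces into `A` because `red_{p^k}` is `ℤ_p`-semilinear (`reduceH1Pk_smul_nat`).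

With `U = Gal(ℚ̄/ℚ_n)`, `A = Sel⁺(E/ℚ_∞)` (`A[2]` finite for a torsion datum with `μ = 0`: `SignedTransportAtTwo.finite_torsionBy_signedSelmerInfty`)
this is the compact form of input (Λ3) of the road; the remaining instantiation (the maps `ι_{n,k}`, their injectivity from
`E(ℚ_∞)[2] = 0`, and the `γ`/`p_*`/`Cor`-stability and finiteness of the pulled-back level groups) is NOT done here.
HONEST FRAMING: closes nothing; 23110 is NOT proved; BSD is not proved by any of this.
References: [GreenbergLNM1716] §1 p. 60, §3 Lemma 3.1; [Kato2004Asterisque] §13.8 (p. 228); [Rubin2000] App. B Prop. B.2.3;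
[NeukirchSchmidtWingberg2008] Ch. V §3.
-/

set_option autoImplicit false
-- D-0017: single-problem summit, so `Summit.BirchSwinnertonDyer.BirchSwinnertonDyer.…` repeats a namespace BY DESIGN.
set_option linter.dupNamespace false

noncomputable section

open scoped AddSubgroup
open Field CategoryTheory
open Literature.NumberTheory.GaloisRepresentations
open Literature.NumberTheory.EllipticCurves Literature.NumberTheory.EllipticCurves.Kato2004
open Literature.NumberTheory.EllipticCurves.Kato2004.EulerSystemValues

namespace Summit.BirchSwinnertonDyer.BirchSwinnertonDyer.Theorems.ResidualThetaLayer.TowerVanishing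

variable {p : ℕ} [Fact p.Prime] {W : WeierstrassCurve ℚ} [W.IsElliptic] [ContinuousSMul ℤ_[p] (W.tateModule p)]

/-- **The rank bound of the engine for pulled-back level groups.** Let `U ≤ Γ_ℚ` with `H¹(U, T_pE)` free of `p`-torsion, let
`ι_k : H¹(U, E[p^k]) → H_∞` be injective additive maps into an abelian group, and `A ≤ H_∞` a subgroup with `A[p]` finite,
`#A[p] ≤ p^d`. Then any `ℤ_p`-linearly independent `v_1, …, v_m ∈ H¹(U, T_pE)` with `ι_k(red_{p^k} v_i) ∈ A` for all `i, k` has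
`m ≤ d`. (The counting `le_of_linearIndependent_of_maps` with `Φ_k = ι_k ∘ red_{p^k}`: kernel in `p^k H¹` by the Bockstein sequence,
values killed by `p^k`, `H¹(U, T_pE)` separated, and the lattice reduces into `A` by semilinearity of `red_{p^k}`.)
[cite: GreenbergLNM1716, §1 p. 60 and §3 Lemma 3.1] [cite: Kato2004Asterisque, §13.8 (p. 228)] [cite: Rubin2000, App. B Prop. B.2.3] -/
theorem le_of_linearIndependent_of_reduceH1Pk_mem (U : Subgroup (absoluteGaloisGroup ℚ))
    (htf : ∀ (k : ℕ) (y : H1 (tateRep W p) U), ((p : ℤ_[p]) ^ k) • y = 0 → y = 0)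
    {Hinf : Type*} [AddCommGroup Hinf]
    (ι : ∀ k : ℕ, H1 (W.torsionGaloisModule ((p : ℤ) ^ k)) U →+ Hinf) (hι : ∀ k, Function.Injective (ι k))
    (A : AddSubgroup Hinf) [Finite ((↥A)[(p : ℤ)])] (d : ℕ) (hd : Nat.card ((↥A)[(p : ℤ)]) ≤ p ^ d)
    {m : ℕ} (v : Fin m → H1 (tateRep W p) U) (hv : LinearIndependent ℤ_[p] v)
    (hvA : ∀ (i : Fin m) (k : ℕ), ι k (reduceH1Pk W p k U (v i)) ∈ A) : m ≤ d := by
  classical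
  refine le_of_linearIndependent_of_maps (V := H1 (tateRep W p) U) htf
    (fun y hy ↦ eq_zero_of_forall_mem_pow_smul W p U y hy) v hv A d hd
    (fun k ↦ (ι k).comp (reduceH1Pk W p k U)) (fun k x hx ↦ ?_) (fun k x ↦ ?_) (fun k a ↦ ?_)
  · -- kernel: `ι_k` injective, then the Bockstein sequence
    refine KatoFiniteLevelCount.exists_pow_smul_eq_of_reduceH1Pk_eq_zero W p k U x (hι k ?_)
    rw [(ι k).map_zero]
    exact hx
  · -- `p^k` kills the values
    have h0 : p ^ k • reduceH1Pk W p k U x = 0 :=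
      WeierstrassCurve.LambdaAdicSelmerDataExists.pow_nsmul_eq_zero W p U k _
    rw [AddMonoidHom.comp_apply, ← map_nsmul, h0, map_zero]
  · -- the lattice reduces into `A` (semilinearity of `red_{p^k}`)
    rw [AddMonoidHom.comp_apply, map_sum, map_sum]
    refine A.sum_mem fun i _ ↦ ?_
    rw [reduceH1Pk_smul_nat, map_nsmul]
    exact A.nsmul_mem (hvA i k) _

end Summit.BirchSwinnertonDyer.BirchSwinnertonDyer.Theorems.ResidualThetaLayer.TowerVanishing

end
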